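import Literature.AlgebraicGeometry.HodgeTheory.CyclicCoverReflectionMonodromy
import Literature.AlgebraicGeometry.Motives.UniversalHypersurfaceFamily
import HarnessLib

/-!
# The Carlson–Toledo coefficient specialisation: ternary `p`-forms `f` ↦ quaternary `p`-forms `x₃^p − f`

Family `hodge`, layer `Literature/AlgebraicGeometry/HodgeTheory`; definitions and theorems, no named fact.
Written by the prover seat `hodge-nonav-prover-Ax` (g4) for route `CyclicUnitaryPowers` of the Hodge summit
(crux K1 `VeryGeneralDeckCommutatorsInHg`, stmt-HodgeConjecture-19544): the algebra of step (3a) — the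
CONSTRUCTION of the universal family of cyclic covers of the plane of the cited fact
`nonempty_carlsonToledoFamily` (file `HodgeTheory/CyclicCoverUniversalFamily`) as the sub-family of the
universal family of smooth quaternary `p`-ics (`Motives/SpecialisedHypersurfaceFamily`) through the
coefficient specialisation below.

* §1 `TernaryIndex p` — exponents `e` of ternary degree-`p` monomials (the coordinates `b_e = coeff_e f` of
  `ℂ^{N+1}`, Carlson–Toledo §2); `extendExp e = (e, 0)`, `restrictExp m = m|_{x₀,x₁,x₂}` and their bookkeeping.
* §2 `cyclicCoverSpz p : ℂ[a_m | |m| = p] →ₐ[ℂ] ℂ[b_e | |e| = p]` — **`a_{x₃^p} ↦ 1`, `a_{(e,0)} ↦ −b_e`, every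
  other coefficient `↦ 0`**: the comorphism of the affine-linear embedding `f ↦ x₃^p − f` (surjective for
  `p ≠ 0`, `cyclicCoverSpz_surjective`).
* §3 `ternaryCoeffHom p f : b_e ↦ coeff_e f` and **`ternaryCoeffHom_comp_cyclicCoverSpz`:
  `ψ_f ∘ φ_p = coeffHom (x₃^p − f)`** — the cyclic cover form `cyclicCoverForm p f` IS the form of the parameter
  `(coeff_e f)_e` of the specialised family (`coeff_cyclicCoverForm`); `eq_of_coeffHom_eq`.

## References

* J. A. Carlson, D. Toledo, Discriminant complements and kernels of monodromy representations, Duke Math. J. 97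
  (1999), §2 ("`𝒴 = {(x, y, a) : y^k + Σ a_L x^L = 0}`", the universal family of cyclic covers; held text
  p0004). [CarlsonToledo1999]
* C. Voisin, *Hodge Theory and Complex Algebraic Geometry II* (2003), §6.2.1. [VoisinHodgeII2003]
-/

noncomputable section

namespace Literature.AlgebraicGeometry.HodgeTheory

open Literature.AlgebraicGeometry.Motives Literature.AlgebraicGeometry.Motives.UniversalHypersurface

/-! ### §1 Exponents: ternary degree-`p` monomials inside the quaternary ones -/

section Exponents

variable {p : ℕ}

/-- The exponents of the ternary monomials of degree `p`: the coordinates `b_e = coeff_e f` of a ternary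
`p`-form `f` (the parameter space `ℂ^{N+1}` of `CarlsonToledo1999` §2). [cite: CarlsonToledo1999, §2 (held text p0004)] -/
abbrev TernaryIndex (p : ℕ) : Type := {e : Fin 3 →₀ ℕ // e.degree = p}

/-- The quaternary exponent `(e, 0)` of a ternary exponent `e` (the monomial `x^e` read in `ℂ[x₀, …, x₃]`).
[folklore] -/
def extendExp (e : Fin 3 →₀ ℕ) : Fin 4 →₀ ℕ := e.mapDomain Fin.castSucc

/-- The ternary exponent `m|_{x₀,x₁,x₂}` of a quaternary exponent `m`. [folklore] -/
def restrictExp (m : Fin 4 →₀ ℕ) : Fin 3 →₀ ℕ :=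
  m.comapDomain Fin.castSucc (Fin.castSucc_injective 3).injOn

/-- `(e, 0)|_{x₀,x₁,x₂} = e`. [folklore] -/
@[simp]
private theorem restrictExp_extendExp (e : Fin 3 →₀ ℕ) : restrictExp (extendExp e) = e :=
  Finsupp.comapDomain_mapDomain _ (Fin.castSucc_injective 3) _

/-- `(e, 0)` has last coordinate `0`. [folklore] -/
@[simp]
private theorem extendExp_last (e : Fin 3 →₀ ℕ) : extendExp e (Fin.last 3) = 0 :=
  Finsupp.mapDomain_notin_range _ _ (fun ⟨j, hj⟩ => (Fin.castSucc_lt_last j).ne hj)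

/-- `(e, 0)` at `xⱼ`, `j < 3`, is `e j`. [folklore] -/
@[simp]
private theorem extendExp_castSucc (e : Fin 3 →₀ ℕ) (j : Fin 3) : extendExp e (Fin.castSucc j) = e j :=
  Finsupp.mapDomain_apply (Fin.castSucc_injective 3) _ _

/-- A quaternary exponent with last coordinate `0` is `(m|, 0)`. [folklore] -/
private theorem extendExp_restrictExp {m : Fin 4 →₀ ℕ} (hm : m (Fin.last 3) = 0) : extendExp (restrictExp m) = m := by
  refine Finsupp.mapDomain_comapDomain _ (Fin.castSucc_injective 3) _ fun i hi => ?_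
  rcases Fin.eq_castSucc_or_eq_last i with ⟨j, rfl⟩ | rfl
  · exact ⟨j, rfl⟩
  · exact absurd hm (by simpa using hi)

/-- `|(e, 0)| = |e|`. [folklore] -/
private theorem degree_extendExp (e : Fin 3 →₀ ℕ) : (extendExp e).degree = e.degree :=
  Finsupp.degree_mapDomain _ _

/-- `|m|_{x₀,x₁,x₂}| = |m|` when `m` has last coordinate `0`. [folklore] -/
private theorem degree_restrictExp {m : Fin 4 →₀ ℕ} (hm : m (Fin.last 3) = 0) : (restrictExp m).degree = m.degree := by
  conv_rhs => rw [← extendExp_restrictExp hm]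
  rw [degree_extendExp]

/-- `(e, 0) ≠ p·e₃` for `p ≠ 0`. [folklore] -/
private theorem extendExp_ne_single (hp : p ≠ 0) (e : Fin 3 →₀ ℕ) : extendExp e ≠ Finsupp.single (Fin.last 3) p := by
  intro h
  have h' := congrArg (fun m : Fin 4 →₀ ℕ => m (Fin.last 3)) h
  simp only [extendExp_last, Finsupp.single_eq_same] at h'
  exact hp h'.symm

/-- The quaternary exponent `(e, 0)` of a ternary degree-`p` exponent, as a `DegIndex 2 p`. [folklore] -/
def extendIndex (e : TernaryIndex p) : DegIndex 2 p := ⟨extendExp e.1, by rw [degree_extendExp]; exact e.2⟩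

/-- The ternary index `m|` of a quaternary degree-`p` exponent with last coordinate `0`. [folklore] -/
def restrictIndex (m : DegIndex 2 p) (hm : m.1 (Fin.last 3) = 0) : TernaryIndex p :=
  ⟨restrictExp m.1, by rw [degree_restrictExp hm]; exact m.2⟩

/-- `coeff_{(e,0)} (rename castSucc f) = coeff_e f`. [folklore] -/
private theorem coeff_extendExp_rename (f : MvPolynomial (Fin 3) ℂ) (e : Fin 3 →₀ ℕ) :
    MvPolynomial.coeff (extendExp e) (MvPolynomial.rename Fin.castSucc f) = MvPolynomial.coeff e f :=
  MvPolynomial.coeff_rename_mapDomain _ (Fin.castSucc_injective 3) _ _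

/-- `coeff_m (rename castSucc f) = 0` if `m` has positive last coordinate. [folklore] -/
private theorem coeff_rename_eq_zero_of_last_ne {m : Fin 4 →₀ ℕ} (hm : m (Fin.last 3) ≠ 0) (f : MvPolynomial (Fin 3) ℂ) :
    MvPolynomial.coeff m (MvPolynomial.rename Fin.castSucc f) = 0 := by
  refine MvPolynomial.coeff_rename_eq_zero _ _ _ fun u hu => ?_
  exfalso
  apply hm
  rw [← hu]
  exact extendExp_last u

end Exponents

/-! ### §2 The coefficient specialisation `a_{x₃^p} ↦ 1`, `a_{(e,0)} ↦ −b_e`, mixed `↦ 0` -/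

section Specialisation

variable (p : ℕ)

open scoped Classical in
/-- **The Carlson–Toledo coefficient specialisation** `φ_p : ℂ[a_m | |m| = p] → ℂ[b_e | |e| = p]`
(`m` quaternary, `e` ternary): the form `Σ a_m x^m` is specialised to `x₃^p − Σ_e b_e x^{(e,0)}`, i.e.
`a_{x₃^p} ↦ 1`, `a_{(e,0)} ↦ −b_e`, every coefficient of a monomial divisible by `x₃` but `≠ x₃^p` `↦ 0` — the
comorphism of the affine-linear embedding `f ↦ x₃^p − f` of the space of ternary `p`-forms into the space of
quaternary `p`-forms ("`𝒴 = {(x, y, a) : y^k + Σ a_L x^L = 0}`", `k = d = p`).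
[cite: CarlsonToledo1999, §2 (universalcyclic) (held text p0004)] -/
def cyclicCoverSpz : CoeffRing ℂ 2 p →ₐ[ℂ] MvPolynomial (TernaryIndex p) ℂ :=
  MvPolynomial.aeval fun m : DegIndex 2 p =>
    if m.1 = Finsupp.single (Fin.last 3) p then 1
    else if hm : m.1 (Fin.last 3) = 0 then -MvPolynomial.X (restrictIndex m hm) else 0

/-- `φ_p (a_m) = 1` for `m = x₃^p`. [cite: CarlsonToledo1999, §2 (universalcyclic) (held text p0004)] -/
theorem cyclicCoverSpz_X_of_eq_single (m : DegIndex 2 p) (hm : m.1 = Finsupp.single (Fin.last 3) p) :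
    cyclicCoverSpz p (MvPolynomial.X m) = 1 := by
  classical
  rw [cyclicCoverSpz, MvPolynomial.aeval_X, if_pos hm]

/-- `φ_p (a_m) = −b_{m|}` for `m = (m|, 0) ≠ x₃^p`. [cite: CarlsonToledo1999, §2 (universalcyclic) (held text p0004)] -/
theorem cyclicCoverSpz_X_of_last_eq_zero (m : DegIndex 2 p) (hm : m.1 ≠ Finsupp.single (Fin.last 3) p)
    (hm0 : m.1 (Fin.last 3) = 0) : cyclicCoverSpz p (MvPolynomial.X m) = -MvPolynomial.X (restrictIndex m hm0) := by
  classical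
  rw [cyclicCoverSpz, MvPolynomial.aeval_X, if_neg hm, dif_pos hm0]

/-- `φ_p (a_{(e,0)}) = −b_e` (`p ≠ 0`). [cite: CarlsonToledo1999, §2 (universalcyclic) (held text p0004)] -/
theorem cyclicCoverSpz_X_extendIndex (hp : p ≠ 0) (e : TernaryIndex p) :
    cyclicCoverSpz p (MvPolynomial.X (extendIndex e)) = -MvPolynomial.X e := by
  rw [cyclicCoverSpz_X_of_last_eq_zero p (extendIndex e) (extendExp_ne_single hp e.1) (extendExp_last e.1)]
  congr 2
  exact Subtype.ext (restrictExp_extendExp e.1)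

/-- `φ_p (a_m) = 0` for `m` divisible by `x₃`, `m ≠ x₃^p`. [cite: CarlsonToledo1999, §2 (universalcyclic) (held text p0004)] -/
theorem cyclicCoverSpz_X_of_last_ne (m : DegIndex 2 p) (hm : m.1 (Fin.last 3) ≠ 0)
    (hm' : m.1 ≠ Finsupp.single (Fin.last 3) p) : cyclicCoverSpz p (MvPolynomial.X m) = 0 := by
  classical
  rw [cyclicCoverSpz, MvPolynomial.aeval_X, if_neg hm', dif_neg hm]

/-- The sign involution `b ↦ −b` of `ℂ[b]`. [folklore] -/
private def negVars : MvPolynomial (TernaryIndex p) ℂ →ₐ[ℂ] MvPolynomial (TernaryIndex p) ℂ :=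
  MvPolynomial.aeval fun e => -MvPolynomial.X e

/-- `b ↦ −b` is an involution. [folklore] -/
private theorem negVars_negVars (q : MvPolynomial (TernaryIndex p) ℂ) : negVars p (negVars p q) = q := by
  have h : (negVars p).comp (negVars p) = AlgHom.id ℂ _ := by
    refine MvPolynomial.algHom_ext fun e => ?_
    simp [negVars]
  exact congrArg (fun χ : MvPolynomial (TernaryIndex p) ℂ →ₐ[ℂ] MvPolynomial (TernaryIndex p) ℂ => χ q) h

/-- `φ_p ∘ rename (e ↦ (e,0))` is the sign involution `b ↦ −b` (`p ≠ 0`).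
[cite: CarlsonToledo1999, §2 (universalcyclic) (held text p0004)] -/
theorem cyclicCoverSpz_rename_extendIndex (hp : p ≠ 0) (q : MvPolynomial (TernaryIndex p) ℂ) :
    cyclicCoverSpz p (MvPolynomial.rename (extendIndex (p := p)) q) =
      MvPolynomial.aeval (fun e : TernaryIndex p => -MvPolynomial.X e) q := by
  have h : (cyclicCoverSpz p).comp (MvPolynomial.rename (extendIndex (p := p))) =
      MvPolynomial.aeval fun e : TernaryIndex p => -MvPolynomial.X e := by
    refine MvPolynomial.algHom_ext fun e => ?_
    rw [AlgHom.comp_apply, MvPolynomial.rename_X, cyclicCoverSpz_X_extendIndex p hp, MvPolynomial.aeval_X]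
  exact congrArg (fun χ : MvPolynomial (TernaryIndex p) ℂ →ₐ[ℂ] MvPolynomial (TernaryIndex p) ℂ => χ q) h

/-- `φ_p` is surjective (`p ≠ 0`): `b_e = φ_p(−a_{(e,0)})`. [cite: CarlsonToledo1999, §2 (universalcyclic) (held text p0004)] -/
theorem cyclicCoverSpz_surjective (hp : p ≠ 0) : Function.Surjective (cyclicCoverSpz p) := fun q =>
  ⟨MvPolynomial.rename (extendIndex (p := p)) (negVars p q), by
    rw [cyclicCoverSpz_rename_extendIndex p hp]; exact negVars_negVars p q⟩

end Specialisation


/-! ### §3 The forms `x₃^p − f` of the sub-family: coefficients -/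

section Forms

variable (p : ℕ)

/-- The coefficient homomorphism `ψ_f : ℂ[b_e] → ℂ`, `b_e ↦ coeff_e f`, of a ternary form `f`.
[cite: CarlsonToledo1999, §2 (held text p0004)] -/
def ternaryCoeffHom (f : MvPolynomial (Fin 3) ℂ) : MvPolynomial (TernaryIndex p) ℂ →ₐ[ℂ] ℂ :=
  MvPolynomial.aeval fun e : TernaryIndex p => f.coeff e.1

/-- `ψ_f (b_e) = coeff_e f`. [cite: CarlsonToledo1999, §2 (held text p0004)] -/
@[simp]
theorem ternaryCoeffHom_X (f : MvPolynomial (Fin 3) ℂ) (e : TernaryIndex p) :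
    ternaryCoeffHom p f (MvPolynomial.X e) = f.coeff e.1 :=
  MvPolynomial.aeval_X _ _

/-- Evaluating a coordinate polynomial at the coefficient vector of `f` is applying `ψ_f` (the shape
`MvPolynomial.eval (fun d => f.coeff d.1) g` of `CarlsonToledoFamily.exists_polynomials`).
[cite: CarlsonToledo1999, §2 (held text p0004)] -/
theorem eval_coeff_eq_ternaryCoeffHom (f : MvPolynomial (Fin 3) ℂ) (g : MvPolynomial (TernaryIndex p) ℂ) :
    MvPolynomial.eval (fun d : TernaryIndex p => f.coeff d.1) g = ternaryCoeffHom p f g :=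
  rfl

/-- **The coefficients of the cyclic cover form** `x₃^p − f`: `[m = x₃^p] − [x₃ ∤ m]·coeff_{m|} f`. [cite: CarlsonToledo1999, §2 (universalcyclic) (held text p0004)] -/
theorem coeff_cyclicCoverForm (f : MvPolynomial (Fin 3) ℂ) (m : Fin 4 →₀ ℕ) :
    MvPolynomial.coeff m (cyclicCoverForm p f) =
      (if m = Finsupp.single (Fin.last 3) p then 1 else 0) -
        (if m (Fin.last 3) = 0 then f.coeff (restrictExp m) else 0) := by
  classical
  rw [cyclicCoverForm_def, MvPolynomial.coeff_sub, MvPolynomial.coeff_X_pow]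
  congr 1
  · simp only [eq_comm]
  · by_cases hm : m (Fin.last 3) = 0
    · rw [if_pos hm]
      have h := coeff_extendExp_rename f (restrictExp m)
      rwa [extendExp_restrictExp hm] at h
    · rw [if_neg hm, coeff_rename_eq_zero_of_last_ne hm]

/-- **The coefficient vector of `x₃^p − f` factors through `φ_p`**: `ψ_f ∘ φ_p = coeffHom (x₃^p − f)` (`p ≠ 0`),
i.e. `x₃^p − f` is the form of the parameter `b = (coeff_e f)_e` of the specialised family.
[cite: CarlsonToledo1999, §2 (universalcyclic) (held text p0004)] -/
theorem ternaryCoeffHom_comp_cyclicCoverSpz (hp : p ≠ 0) (f : MvPolynomial (Fin 3) ℂ) :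
    (ternaryCoeffHom p f).comp (cyclicCoverSpz p) = coeffHom ℂ 2 p (cyclicCoverForm p f) := by
  refine MvPolynomial.algHom_ext fun m => ?_
  rw [AlgHom.comp_apply, MvPolynomial.aeval_X, coeff_cyclicCoverForm p]
  by_cases h1 : m.1 = Finsupp.single (Fin.last 3) p
  · have h2 : m.1 (Fin.last 3) ≠ 0 := by rw [h1, Finsupp.single_eq_same]; exact hp
    rw [cyclicCoverSpz_X_of_eq_single p m h1, map_one, if_pos h1, if_neg h2, sub_zero]
  · by_cases h2 : m.1 (Fin.last 3) = 0
    · rw [cyclicCoverSpz_X_of_last_eq_zero p m h1 h2, map_neg, ternaryCoeffHom_X, if_neg h1, if_pos h2, zero_sub]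
      rfl
    · rw [cyclicCoverSpz_X_of_last_ne p m h2 h1, map_zero, if_neg h1, if_neg h2, sub_zero]

/-- Two forms of degree `d` with the same coefficient homomorphism (the same point of `S^d = H⁰(ℙⁿ⁺¹, 𝒪(d))`) are
equal. [cite: VoisinHodgeII2003, §6.2.1] -/
theorem eq_of_coeffHom_eq {n d : ℕ} {G G' : MvPolynomial (Fin (n + 2)) ℂ} (hG : G.IsHomogeneous d)
    (hG' : G'.IsHomogeneous d) (h : coeffHom ℂ n d G = coeffHom ℂ n d G') : G = G' := by
  rw [← map_coeffHom_universalForm ℂ n d G hG, ← map_coeffHom_universalForm ℂ n d G' hG', h]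

end Forms


end Literature.AlgebraicGeometry.HodgeTheory

end
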